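import Literature.Geometry.Lorentzian.DevelopmentGluingData
import Literature.Geometry.Lorentzian.MaximalCommonDevelopment
import HarnessLib

/-!
# A common globally hyperbolic development with corresponding boundary points is not maximal
# (Sbierski 2016, Thm. 12) — named statement

J. Sbierski, *On the existence of a maximal Cauchy development for the Einstein equations: a
dezornification*, Ann. Henri Poincaré 17 (2016) 301–329 = arXiv:1309.7591v3, §3.2, Theorem 12
(arXiv numbering; Ann. Henri Poincaré Thm. 3.5): *"Let `M` and `M'` be GHDs of the same initial
data, and say `U` is a CGHD of `M` and `M'`. If there are corresponding boundary points of `U` in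
`M` and `M'`, then there exists a strictly larger extension of `U` that is also a CGHD of `M` and
`M'`. In particular, `U` is not the MCGHD of `M` and `M'`."* The printed proof (§3.2, Prop. 13,
Lemmas 14–16) rests on the causality theory of globally hyperbolic manifolds (O'Neill 1983,
Ch. 14; Ringström 2009, Ch. 23) and a further application of local existence and uniqueness for
the vacuum Einstein equations (Thm. 4) across a spacelike piece of `∂U`; it is being formalised in
this directory (`CorrespondingBoundaryTimelike`, `CorrespondingBoundaryLimit`,
`SpacelikeBoundaryFuturePoint`, `SubdevelopmentTimelikeEntry`, …) and is the displayed input `h12`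
of `MCGHDNoCorrespondingBoundary.lean` / `MGHDExistenceReduction.lean`. This file records the
statement as a named proposition over the tree's objects — a common development datum
`𝔠 = (U ⊆ M₁, ψ)` of two vacuum Cauchy developments of the same data
(`CauchyDevelopment.CommonDevelopment`, Def. 2.4 realised in `M₁`, file `DevelopmentGluingData`),
corresponding boundary points (`CommonDevelopment.HasCorrespondingBoundaryPoints`, Def. 11), and
the conclusion "some common development `V ⊆ M₁` strictly contains `U`"
(`CauchyDevelopment.IsCommonDevelopment … V ∧ 𝔠.opens < V`, file `MaximalCommonDevelopment`; the
immersion of `V` extends `ψ` by Cor. 8, `IsCommonDevelopment.apply_eq_apply`) — in dimension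
`3 + 1`, the case used by the Cauchy problem files of `Summits/FinalStateConjecture`.

* `Literature.Geometry.Lorentzian.sbierski_commonDevelopment_lt_of_hasCorrespondingBoundaryPoints`

## References

* J. Sbierski, Ann. Henri Poincaré 17 (2016) 301–329 = arXiv:1309.7591v3, §3.2, Def. 11,
  Thm. 12 (arXiv numbering). [Sbierski2016AHP]
-/

namespace Literature.Geometry.Lorentzian

open Function Set Filter Topology TopologicalSpace
open scoped Manifold ContDiff Topology

/-- **Sbierski 2016, Theorem 12 ("NotMCGHD"), for vacuum developments of the same data, dimension
`3 + 1`**: *"Let `M` and `M'` be GHDs of the same initial data, and say `U` is a CGHD of `M` and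
`M'`. If there are corresponding boundary points of `U` in `M` and `M'`, then there exists a
strictly larger extension of `U` that is also a CGHD of `M` and `M'`."* — for every connected
smooth `3`-manifold `N`, initial data set `D₁` on `N`, vacuum Cauchy developments `𝒟₁`, `𝒟₂` of
`D₁` and common development datum `𝔠 = (U ⊆ M₁, ψ)` of `𝒟₁` and `𝒟₂` with corresponding boundary
points, some common development `V ⊆ M₁` of `𝒟₁` and `𝒟₂` strictly contains `U`.
(TODO(general form): Sbierski's theorem is stated for globally hyperbolic developments of any
dimension; the vacuum condition enters its proof only through Thm. 4.)
[cite: Sbierski2016AHP, §3.2, Thm. 12 (arXiv numbering) = Ann. Henri Poincaré 17 (2016), Thm. 3.5]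
[file Geometry/Lorentzian/CommonDevelopmentProperExtension] -/
def sbierski_commonDevelopment_lt_of_hasCorrespondingBoundaryPoints : Prop :=
  ∀ (N : Type) [TopologicalSpace N] [ChartedSpace (EuclideanSpace ℝ (Fin 3)) N]
    [IsManifold (modelWithCornersSelf ℝ (EuclideanSpace ℝ (Fin 3))) ((⊤ : ℕ∞) : WithTop ℕ∞) N]
    [ConnectedSpace N]
    (D₁ : Literature.Geometry.Lorentzian.InitialDataSet
      (modelWithCornersSelf ℝ (EuclideanSpace ℝ (Fin 3))) N)
    (𝒟₁ 𝒟₂ : Literature.Geometry.Lorentzian.VacuumCauchyDevelopment D₁)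
    (𝔠 : Literature.Geometry.Lorentzian.CauchyDevelopment.CommonDevelopment
      𝒟₁.toCauchyDevelopment 𝒟₂.toCauchyDevelopment),
    𝔠.HasCorrespondingBoundaryPoints →
      ∃ V : TopologicalSpace.Opens 𝒟₁.carrier,
        Literature.Geometry.Lorentzian.CauchyDevelopment.IsCommonDevelopment
            𝒟₁.toCauchyDevelopment 𝒟₂.toDataEmbedding V ∧
          𝔠.opens < V

end Literature.Geometry.Lorentzian
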